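import Summits.KontsevichZagierPeriods.KontsevichZagierPeriods.Theses.AbelContraction
import Summits.KontsevichZagierPeriods.KontsevichZagierPeriods.Theorems.AbelContractionRealArcKernelVolumeFiltration
import Summits.KontsevichZagierPeriods.KontsevichZagierPeriods.Theorems.AbelContractionRealArcKernelStrength

/-!
# KontsevichZagierPeriods / AbelContraction — crux `RealArcKernel` (stmt-KontsevichZagierPeriods-12472),
# line `dimtwo_redirect`: the open stub `stub_solidVolumes` in the currency of PAIRS OF ONE DIMENSION LESS
# (support file, lands `--supports`; lead c5)

The registered line of the crux has two open stubs, `stub_solidVolumes` (`VolSolid 3`: two BOUNDED volume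
representations of dimension `3` — bounded `ℚ`-semialgebraic solids with integrand `1` — of equal volume are
KZ-equivalent) and `stub_reductionToDimensionTwo` (item stmt-18030 verbatim). The first is the residue of
item stmt-4280's line `bounded_solids` and IMPLIES stmt-4280 (`KZDimTwo`: Conjecture 1 for pairs of
KZ-RATIONAL representations of dimensions `≤ 2`; landed `RealArcKernelSolidVolumes.kzDimTwo_of_solidVolumes`).
This file says exactly by how much the stub over-shoots the item. For every `d`, sorry-free:

* `sub_mem_of_dimPairs_mem` — if `R ≥ KZ.relations` contains `[a] − [b]` for every equal-valued pair of
  representations `a b` of dimension EXACTLY `d` (arbitrary `ℚ`-semialgebraic integrands), then it contains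
  `[u] − [v]` for every equal-volume pair of volume representations `u v` of dimension `d + 1` (bounded or
  not). Proof: volumes DESCEND one dimension (`NilradicalCut.volumeDescent`: cylindrical decomposition
  adapted to the solid — Basu–Pollack–Roy Cor. 5.7, PROVED in the tree as
  `IsSemialgebraic.exists_cylindricalDecomposition_holds` — and Newton–Leibniz down the inner bands), the
  descended `ℤ`-combinations are normalised INSIDE dimension `d` to differences `[a] − [b]`
  (`exists_sub_of_mem_closure_range`: merge by extension-by-zero and integrand additivity,
  `RealArcKernelStrength.exists_sameDim_of_add_sub_of_mem_relations`), cross-merge, compare values by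
  soundness.
* `volSolid_iff_pairs_dim` / `volSolid_iff_pairs_dim_le` — **`VolSolid (d+1)` ⟺ Conjecture 1 for pairs of
  representations of dimension exactly `d` ⟺ Conjecture 1 for pairs of dimensions `≤ d`** (no rationality
  hypothesis anywhere; `→` is the landed `RealArcKernelVolumeFiltration.equivalent_of_volSolid`).
* `redSolid_iff_redPairs_dim` — the same for the tails relative to `R ≥ KZ.relations`:
  `RedSolid (d+1) ⟺ RedPairs d`.
* `d = 2`, in the literal currency of the registered stubs: `solidVolumes_iff_planarPairs` — **the open
  stub `stub_solidVolumes` IS Conjecture 1 for pairs of PLANAR integrals `∫_σ f`, `σ ⊆ ℝ²`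
  `ℚ`-semialgebraic, `f` real-algebraic (`ℚ`-semialgebraic) on `σ`** — i.e. item stmt-4280 `KZDimTwo`
  with the hypothesis `IsRational` DELETED (`solidVolumes_iff_pairs_dim_le_two`, `kzDimTwo_of_planarPairs`);
  and `redSolid_three_iff_redPlanarPairs`, `redPlanarPairs_of_reductionToDimensionTwo` for the tail.

So the gap between the line's first stub and the strategist's split child stmt-4280 is exactly the passage
from real-algebraic to rational integrands INSIDE dimension two (Kontsevich–Zagier's remark "algebraic may
be replaced by rational" costs dimensions); nothing else — in particular no cylindrical-decomposition debt
remains (lead c4's census listed it as an unproved named fact; it is `…_holds` in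
`Literature/ModelTheory/ExponentialFields/CylindricalDecompositionProofs.lean`).

Sources: M. Kontsevich, D. Zagier, *Periods* (2001), §1.1 (remark after the Definition), §1.2 rules
(1), (3), Conjecture 1; J. Cresson, J. Viu-Sos, JTNB 34 (2022), §1 p. 326 (volume form); J. Viu-Sos,
IJNT 17 (2021), Thm. 1.1; S. Basu, R. Pollack, M.-F. Roy (2006), Cor. 5.7.
Deliberately NOT here: any attack on `VolSolid 3` / stmt-4280 / stmt-18030 themselves. No definition is
introduced (`VolSolid`, `RedSolid`, `RedPairs` are words for the displayed formulas).
-/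

noncomputable section

open Literature.NumberTheory.Transcendental
open Summit.KontsevichZagierPeriods.LiouvilleUnfolding.NilradicalCut (volumeDescent)
open Summit.KontsevichZagierPeriods.AbelContraction.RealArcKernelStrength
  (exists_sameDim_of_add_sub_of_mem_relations)
open Summit.KontsevichZagierPeriods.AbelContraction.RealArcKernelVolumeFiltration
  (sub_mem_of_solidPairs_dim equivalent_of_volSolid)
open Summit.KontsevichZagierPeriods.KontsevichZagierPeriods.Theses.AbelContraction
  (KZDimTwo ReductionToDimensionTwo)

namespace Summit.KontsevichZagierPeriods.AbelContraction.RealArcKernelStubCurrency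

variable {d : ℕ}

/-! ## Normal form inside one dimension -/

/-- **Normal form inside dimension `d`.** Every element of the subgroup of `KZ.FormalRep` generated by the
representations of dimension exactly `d` is, modulo `KZ.relations`, a difference `[a] − [b]` of two
representations of dimension `d`: generators `[r] ≡ [r] − [∅]`, sums are merged inside dimension `d`
(`exists_sameDim_of_add_sub_of_mem_relations`: rules (1a), (1b) only), `−([a] − [b]) = [b] − [a]`.
[cite: KontsevichZagier2001, §1.2 rule (1)] -/
theorem exists_sub_of_mem_closure_range {x : KZ.FormalRep}
    (hx : x ∈ AddSubgroup.closure (Set.range fun b : KZ.IntegralRep d => KZ.of b)) :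
    ∃ a b : KZ.IntegralRep d, x - (KZ.of a - KZ.of b) ∈ KZ.relations := by
  induction hx using AddSubgroup.closure_induction with
  | mem y hy =>
    obtain ⟨r, rfl⟩ := hy
    refine ⟨r, KZ.IntegralRep.empty d, ?_⟩
    have : KZ.of r - (KZ.of r - KZ.of (KZ.IntegralRep.empty d)) = KZ.of (KZ.IntegralRep.empty d) := by
      abel
    rw [this]
    exact KZ.IntegralRep.of_empty_mem_relations
  | zero =>
    exact ⟨KZ.IntegralRep.empty d, KZ.IntegralRep.empty d, by simp⟩
  | add y z _ _ hy hz =>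
    obtain ⟨a₁, b₁, h₁⟩ := hy
    obtain ⟨a₂, b₂, h₂⟩ := hz
    obtain ⟨M, hM⟩ := exists_sameDim_of_add_sub_of_mem_relations a₁ a₂
    obtain ⟨M', hM'⟩ := exists_sameDim_of_add_sub_of_mem_relations b₁ b₂
    refine ⟨M, M', ?_⟩
    have : y + z - (KZ.of M - KZ.of M') =
        (y - (KZ.of a₁ - KZ.of b₁)) + (z - (KZ.of a₂ - KZ.of b₂)) +
          (KZ.of a₁ + KZ.of a₂ - KZ.of M) - (KZ.of b₁ + KZ.of b₂ - KZ.of M') := by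
      abel
    rw [this]
    exact KZ.relations.sub_mem (KZ.relations.add_mem (KZ.relations.add_mem h₁ h₂) hM) hM'
  | neg y _ hy =>
    obtain ⟨a, b, h⟩ := hy
    refine ⟨b, a, ?_⟩
    have : -y - (KZ.of b - KZ.of a) = -(y - (KZ.of a - KZ.of b)) := by abel
    rw [this]
    exact KZ.relations.neg_mem h

/-- **A volume representation of dimension `d + 1` is `≡ [a] − [b]` with `a b` of dimension `d`**
(integrand `1`, finite volume, bounded or not): volume descent (`volumeDescent`: cylindrical decomposition
and Newton–Leibniz down the inner bands) followed by the normal form inside dimension `d`.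
[cite: KontsevichZagier2001, §1.2 rules (1),(3)] -/
theorem exists_sub_of_integrand_one (u : KZ.IntegralRep (d + 1)) (hu : ∀ z ∈ u.domain, u.integrand z = 1) :
    ∃ a b : KZ.IntegralRep d, KZ.of u - (KZ.of a - KZ.of b) ∈ KZ.relations := by
  obtain ⟨c, hc, e⟩ := volumeDescent d u hu
  obtain ⟨a, b, f⟩ := exists_sub_of_mem_closure_range hc
  refine ⟨a, b, ?_⟩
  have : KZ.of u - (KZ.of a - KZ.of b) = (KZ.of u - c) + (c - (KZ.of a - KZ.of b)) := by abel
  rw [this]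
  exact KZ.relations.add_mem e f

/-! ## Pairs of dimension `d` control the volume pairs of dimension `d + 1`, relative to any `R` -/

/-- **Equal-valued pairs of dimension `d` control equal-volume pairs of dimension `d + 1`, relative to any
`R ≥ KZ.relations`.** If `R` contains `[a] − [b]` for all representations `a b` of dimension exactly `d`
with `a.value = b.value`, then `R` contains `[u] − [v]` for all volume representations `u v` of dimension
`d + 1` (integrand `1`, finite volume — no boundedness needed) with `u.value = v.value`: write
`[u] ≡ [a₁] − [b₁]`, `[v] ≡ [a₂] − [b₂]` (`exists_sub_of_integrand_one`), merge `[a₁] + [b₂] ≡ [M]`,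
`[b₁] + [a₂] ≡ [M′]` inside dimension `d`, so `[u] − [v] ≡ [M] − [M′]` modulo relations and
`M.value = M′.value` by soundness. [cite: KontsevichZagier2001, §1.2 Conjecture 1] -/
theorem sub_mem_of_dimPairs_mem {R : AddSubgroup KZ.FormalRep} (hR : KZ.relations ≤ R)
    (hP : ∀ (a b : KZ.IntegralRep d), a.value = b.value → KZ.of a - KZ.of b ∈ R)
    (u v : KZ.IntegralRep (d + 1)) (hu : ∀ z ∈ u.domain, u.integrand z = 1)
    (hv : ∀ z ∈ v.domain, v.integrand z = 1) (huv : u.value = v.value) :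
    KZ.of u - KZ.of v ∈ R := by
  obtain ⟨a₁, b₁, f₁⟩ := exists_sub_of_integrand_one u hu
  obtain ⟨a₂, b₂, f₂⟩ := exists_sub_of_integrand_one v hv
  obtain ⟨M, hM⟩ := exists_sameDim_of_add_sub_of_mem_relations a₁ b₂
  obtain ⟨M', hM'⟩ := exists_sameDim_of_add_sub_of_mem_relations b₁ a₂
  have key : KZ.of u - KZ.of v - (KZ.of M - KZ.of M') =
      (KZ.of u - (KZ.of a₁ - KZ.of b₁)) - (KZ.of v - (KZ.of a₂ - KZ.of b₂)) +
        (KZ.of a₁ + KZ.of b₂ - KZ.of M) - (KZ.of b₁ + KZ.of a₂ - KZ.of M') := by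
    abel
  have hrel : KZ.of u - KZ.of v - (KZ.of M - KZ.of M') ∈ KZ.relations := by
    rw [key]
    exact KZ.relations.sub_mem (KZ.relations.add_mem (KZ.relations.sub_mem f₁ f₂) hM) hM'
  have hval : M.value = M'.value := by
    have h0 := KZ.eval_eq_zero_of_mem_relations hrel
    rw [map_sub, KZ.eval_of_sub_of, KZ.eval_of_sub_of, huv, sub_self, zero_sub, neg_eq_zero,
      sub_eq_zero] at h0
    exact h0
  have : KZ.of u - KZ.of v = (KZ.of u - KZ.of v - (KZ.of M - KZ.of M')) + (KZ.of M - KZ.of M') := by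
    abel
  rw [this]
  exact R.add_mem (hR hrel) (hP M M' hval)

/-! ## `VolSolid (d+1)` in the currency of pairs of dimension `d` -/

/-- **Conjecture 1 for pairs of dimension exactly `d` implies `VolSolid (d+1)`** (the case
`R = KZ.relations` of `sub_mem_of_dimPairs_mem`; the boundedness hypotheses of `VolSolid` are not used).
[cite: CressonViusos2022, §1 p. 326] -/
theorem volSolid_of_pairs_dim
    (hP : ∀ (a b : KZ.IntegralRep d), a.value = b.value → KZ.Equivalent a b) :
    ∀ (u v : KZ.IntegralRep (d + 1)), (Bornology.IsBounded u.domain ∧ ∀ z ∈ u.domain, u.integrand z = 1) →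
      (Bornology.IsBounded v.domain ∧ ∀ z ∈ v.domain, v.integrand z = 1) → u.value = v.value →
      KZ.Equivalent u v :=
  fun u v hu hv huv => sub_mem_of_dimPairs_mem le_rfl hP u v hu.2 hv.2 huv

/-- **`VolSolid (d+1)` ⟺ Conjecture 1 for pairs of representations of dimension exactly `d`** (arbitrary
`ℚ`-semialgebraic integrands; `→` is the landed `equivalent_of_volSolid` at `n = m = d`).
[cite: CressonViusos2022, §1 p. 326] -/
theorem volSolid_iff_pairs_dim :
    (∀ (u v : KZ.IntegralRep (d + 1)), (Bornology.IsBounded u.domain ∧ ∀ z ∈ u.domain, u.integrand z = 1) →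
      (Bornology.IsBounded v.domain ∧ ∀ z ∈ v.domain, v.integrand z = 1) → u.value = v.value →
      KZ.Equivalent u v) ↔
    ∀ (a b : KZ.IntegralRep d), a.value = b.value → KZ.Equivalent a b :=
  ⟨fun hS a b hab => equivalent_of_volSolid hS le_rfl le_rfl a b hab, volSolid_of_pairs_dim⟩

/-- **`VolSolid (d+1)` ⟺ Conjecture 1 for pairs of representations of dimensions `≤ d`** (arbitrary
`ℚ`-semialgebraic integrands, possibly different dimensions). [cite: CressonViusos2022, §1 p. 326] -/
theorem volSolid_iff_pairs_dim_le :
    (∀ (u v : KZ.IntegralRep (d + 1)), (Bornology.IsBounded u.domain ∧ ∀ z ∈ u.domain, u.integrand z = 1) →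
      (Bornology.IsBounded v.domain ∧ ∀ z ∈ v.domain, v.integrand z = 1) → u.value = v.value →
      KZ.Equivalent u v) ↔
    ∀ ⦃n m : ℕ⦄, n ≤ d → m ≤ d → ∀ (r : KZ.IntegralRep n) (r' : KZ.IntegralRep m),
      r.value = r'.value → KZ.Equivalent r r' :=
  ⟨fun hS _ _ hn hm r r' hv => equivalent_of_volSolid hS hn hm r r' hv,
    fun h => volSolid_of_pairs_dim fun a b hab => h le_rfl le_rfl a b hab⟩

/-- **Pairs of one dimension decide all pairs of lower dimensions**: Conjecture 1 for pairs of dimension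
exactly `d` implies it for pairs of dimensions `≤ d` (through `VolSolid (d+1)`).
[cite: KontsevichZagier2001, §1.2 Conjecture 1] -/
theorem pairs_dim_le_of_pairs_dim
    (hP : ∀ (a b : KZ.IntegralRep d), a.value = b.value → KZ.Equivalent a b)
    {n m : ℕ} (hn : n ≤ d) (hm : m ≤ d) (r : KZ.IntegralRep n) (r' : KZ.IntegralRep m)
    (hv : r.value = r'.value) : KZ.Equivalent r r' :=
  volSolid_iff_pairs_dim_le.mp (volSolid_of_pairs_dim hP) hn hm r r' hv

/-! ## The tails: `RedSolid (d+1)` ⟺ `RedPairs d` -/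

/-- **`RedSolid (d+1)` ⟺ `RedPairs d`**: "every `R ≥ KZ.relations` containing the equal-volume pairs of
bounded solids of dimension `d + 1` contains `ker KZ.eval`" is equivalent to "every `R ≥ KZ.relations`
containing the equal-valued pairs of representations of dimension exactly `d` contains `ker KZ.eval`"
(`sub_mem_of_dimPairs_mem` one way, the landed `sub_mem_of_solidPairs_dim` the other).
[cite: KontsevichZagier2001, §1.2 Conjecture 1] -/
theorem redSolid_iff_redPairs_dim :
    (∀ R : AddSubgroup KZ.FormalRep, KZ.relations ≤ R →
      (∀ (u v : KZ.IntegralRep (d + 1)), (Bornology.IsBounded u.domain ∧ ∀ z ∈ u.domain, u.integrand z = 1) →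
        (Bornology.IsBounded v.domain ∧ ∀ z ∈ v.domain, v.integrand z = 1) → u.value = v.value →
        KZ.of u - KZ.of v ∈ R) →
      ∀ x : KZ.FormalRep, KZ.eval x = 0 → x ∈ R) ↔
    ∀ R : AddSubgroup KZ.FormalRep, KZ.relations ≤ R →
      (∀ (a b : KZ.IntegralRep d), a.value = b.value → KZ.of a - KZ.of b ∈ R) →
      ∀ x : KZ.FormalRep, KZ.eval x = 0 → x ∈ R := by
  constructor
  · intro h R hR hP x hx
    exact h R hR (fun u v hu hv huv => sub_mem_of_dimPairs_mem hR hP u v hu.2 hv.2 huv) x hx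
  · intro h R hR hS x hx
    exact h R hR (fun a b hab => sub_mem_of_solidPairs_dim hR hS le_rfl le_rfl a b hab) x hx

/-! ## `d = 2`: the registered stubs of line `dimtwo_redirect` in the planar-pairs currency -/

/-- **The open stub `stub_solidVolumes` IS Conjecture 1 for pairs of planar integrals**: two bounded
`ℚ`-semialgebraic solids of `ℝ³` of equal volume are KZ-equivalent iff any two representations
`∫_σ f`, `∫_{σ′} f′` of dimension `2` (`σ, σ′ ⊆ ℝ²` `ℚ`-semialgebraic, `f, f′` real-algebraic on them)
with equal value are KZ-equivalent. [cite: CressonViusos2022, §1 p. 326] -/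
theorem solidVolumes_iff_planarPairs :
    (∀ (u v : KZ.IntegralRep 3), (Bornology.IsBounded u.domain ∧ ∀ z ∈ u.domain, u.integrand z = 1) →
      (Bornology.IsBounded v.domain ∧ ∀ z ∈ v.domain, v.integrand z = 1) → u.value = v.value →
      KZ.Equivalent u v) ↔
    ∀ (a b : KZ.IntegralRep 2), a.value = b.value → KZ.Equivalent a b :=
  volSolid_iff_pairs_dim

/-- **The open stub `stub_solidVolumes` IS item stmt-4280 `KZDimTwo` with `IsRational` deleted**:
`VolSolid 3` ⟺ Conjecture 1 for pairs of representations of dimensions `≤ 2` with arbitrary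
`ℚ`-semialgebraic integrands (compare `KZDimTwo`: the same with `r.IsRational → r'.IsRational →`).
[cite: KontsevichZagier2001, §1.2 Conjecture 1] -/
theorem solidVolumes_iff_pairs_dim_le_two :
    (∀ (u v : KZ.IntegralRep 3), (Bornology.IsBounded u.domain ∧ ∀ z ∈ u.domain, u.integrand z = 1) →
      (Bornology.IsBounded v.domain ∧ ∀ z ∈ v.domain, v.integrand z = 1) → u.value = v.value →
      KZ.Equivalent u v) ↔
    ∀ ⦃n m : ℕ⦄, n ≤ 2 → m ≤ 2 → ∀ (r : KZ.IntegralRep n) (r' : KZ.IntegralRep m),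
      r.value = r'.value → KZ.Equivalent r r' :=
  volSolid_iff_pairs_dim_le

/-- **Planar pairs imply item stmt-4280** (`KZDimTwo`, the route decl by name): forget `IsRational`.
[cite: KontsevichZagier2001, §1.2 Conjecture 1] -/
theorem kzDimTwo_of_planarPairs (hP : ∀ (a b : KZ.IntegralRep 2), a.value = b.value → KZ.Equivalent a b) :
    KZDimTwo :=
  fun _ _ hn hm r r' _ _ hv => pairs_dim_le_of_pairs_dim hP hn hm r r' hv

/-- **The tail in the planar-pairs currency**: `RedSolid 3` ⟺ "every `R ≥ KZ.relations` containing the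
equal-valued pairs of representations of dimension `2` contains `ker KZ.eval`" (`RedPlanarPairs`).
[cite: KontsevichZagier2001, §1.2 Conjecture 1] -/
theorem redSolid_three_iff_redPlanarPairs :
    (∀ R : AddSubgroup KZ.FormalRep, KZ.relations ≤ R →
      (∀ (u v : KZ.IntegralRep 3), (Bornology.IsBounded u.domain ∧ ∀ z ∈ u.domain, u.integrand z = 1) →
        (Bornology.IsBounded v.domain ∧ ∀ z ∈ v.domain, v.integrand z = 1) → u.value = v.value →
        KZ.of u - KZ.of v ∈ R) →
      ∀ x : KZ.FormalRep, KZ.eval x = 0 → x ∈ R) ↔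
    ∀ R : AddSubgroup KZ.FormalRep, KZ.relations ≤ R →
      (∀ (a b : KZ.IntegralRep 2), a.value = b.value → KZ.of a - KZ.of b ∈ R) →
      ∀ x : KZ.FormalRep, KZ.eval x = 0 → x ∈ R :=
  redSolid_iff_redPairs_dim

/-- **Item stmt-18030 implies the planar-pairs tail** (`ReductionToDimensionTwo → RedPlanarPairs`): an `R`
containing all equal-valued planar pairs contains in particular the KZ-rational pairs of dimensions `≤ 2`
(`pairs_dim_le_of_pairs_dim` relative to `R`, through the solids). The converse is the open passage from
real-algebraic to rational integrands inside dimension two. [cite: KontsevichZagier2001, §1.2 Conjecture 1] -/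
theorem redPlanarPairs_of_reductionToDimensionTwo (h : ReductionToDimensionTwo) :
    ∀ R : AddSubgroup KZ.FormalRep, KZ.relations ≤ R →
      (∀ (a b : KZ.IntegralRep 2), a.value = b.value → KZ.of a - KZ.of b ∈ R) →
      ∀ x : KZ.FormalRep, KZ.eval x = 0 → x ∈ R := by
  intro R hR hP x hx
  refine h R hR ?_ x hx
  intro n m hn hm r r' _ _ hv
  exact sub_mem_of_solidPairs_dim hR
    (fun u v hu hv' huv => sub_mem_of_dimPairs_mem hR hP u v hu.2 hv'.2 huv) hn hm r r' hv

/-- **The crux from the two stubs in the planar-pairs currency**: Conjecture 1 for planar pairs and the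
planar-pairs tail give `RealArcKernel` (indeed `ker KZ.eval ≤ R` for every `R ≥ KZ.relations`, the sector
hypothesis being idle), through the landed `realArcKernel_of_solidVolumes_of_redSolid`.
[cite: KontsevichZagier2001, §1.2 Conjecture 1] -/
theorem realArcKernel_of_planarPairs_of_redPlanarPairs
    (hP : ∀ (a b : KZ.IntegralRep 2), a.value = b.value → KZ.Equivalent a b)
    (hRed : ∀ R : AddSubgroup KZ.FormalRep, KZ.relations ≤ R →
      (∀ (a b : KZ.IntegralRep 2), a.value = b.value → KZ.of a - KZ.of b ∈ R) →
      ∀ x : KZ.FormalRep, KZ.eval x = 0 → x ∈ R) :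
    Summit.KontsevichZagierPeriods.KontsevichZagierPeriods.Theses.AbelContraction.RealArcKernel := by
  unfold Summit.KontsevichZagierPeriods.KontsevichZagierPeriods.Theses.AbelContraction.RealArcKernel
  intro R hR _ x hx
  exact hRed R hR (fun a b hab => hR (hP a b hab)) x hx

/-! ## `d = 1`: the children of the first split are the rungs `VolSolid 2`, `RedSolid 2`

With the section above this places every item the crux has been split into on ONE ladder (no rationality
hypothesis anywhere on the ladder): `PlanarAreas` (stmt-4990) `= VolSolid 2`, `KZDimTwo` (stmt-4280) lies
between `VolSolid 3 → ·` (`kzDimTwo_of_planarPairs`) and `· → VolSolid 2` (landed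
`RealArcKernelSplit.planarAreas_of_kzDimTwo`), `stub_solidVolumes = VolSolid 3`; and for the tails
`ReductionToDimensionOne` (stmt-14403) `= RedSolid 2`, `ReductionToDimensionTwo` (stmt-18030) lies between
`RedSolid 2 → ·` (landed `RealArcKernelSplit.reductionToDimensionTwo_of_reductionToDimensionOne`) and
`· → RedSolid 3` (landed `RealArcKernelSolidVolumes.redSolid_of_reductionToDimensionTwo`; equivalently
`redPlanarPairs_of_reductionToDimensionTwo` with `redSolid_three_iff_redPlanarPairs`). -/

section DimOne

open Summit.KontsevichZagierPeriods.KontsevichZagierPeriods.Theses.AbelContraction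
  (PlanarAreas ReductionToDimensionOne)

/-- **`PlanarAreas ↔ VolSolid 2`**: the 1-period layer of the route (two planar `ℚ`-semialgebraic sets of
equal finite area are KZ-equivalent) is the rung `d + 1 = 2` of the volume ladder; boundedness is free
(`KZ.exists_isBounded_sub_mem_relations`: grounding and monomial compression).
[cite: ViuSos2021, Thm. 1.1 (Cor. 2.2 replaced)] -/
theorem planarAreas_iff_volSolid_two :
    PlanarAreas ↔
      ∀ (u v : KZ.IntegralRep 2), (Bornology.IsBounded u.domain ∧ ∀ z ∈ u.domain, u.integrand z = 1) →
        (Bornology.IsBounded v.domain ∧ ∀ z ∈ v.domain, v.integrand z = 1) → u.value = v.value →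
        KZ.Equivalent u v := by
  unfold Summit.KontsevichZagierPeriods.KontsevichZagierPeriods.Theses.AbelContraction.PlanarAreas
  constructor
  · intro h u v hu hv huv
    exact h u v hu.2 hv.2 huv
  · intro h s s' hs hs' hv
    obtain ⟨B, hBb, hB1, eB⟩ := KZ.exists_isBounded_sub_mem_relations (m := 1) s hs
    obtain ⟨B', hB'b, hB'1, eB'⟩ := KZ.exists_isBounded_sub_mem_relations (m := 1) s' hs'
    have hvB : B.value = B'.value := by
      rw [← KZ.Equivalent.value_eq_holds eB, ← KZ.Equivalent.value_eq_holds eB', hv]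
    exact (KZ.Equivalent.trans eB (h B B' ⟨hBb, hB1⟩ ⟨hB'b, hB'1⟩ hvB)).trans (KZ.Equivalent.symm eB')

/-- **`PlanarAreas ↔` Conjecture 1 for pairs of ONE-dimensional representations** (arbitrary
real-algebraic integrands over `ℚ`-semialgebraic subsets of `ℝ`): `→` is the landed transfer
`AreasToArcs` (stmt-0117) in another proof, `←` is volume descent at `d = 1`.
[cite: KontsevichZagier2001, §1.2 Conjecture 1] -/
theorem planarAreas_iff_dimOnePairs : Summit.KontsevichZagierPeriods.KontsevichZagierPeriods.Theses.AbelContraction.PlanarAreas ↔ ∀ (a b : KZ.IntegralRep 1), a.value = b.value → KZ.Equivalent a b :=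
  planarAreas_iff_volSolid_two.trans volSolid_iff_pairs_dim

/-- **`ReductionToDimensionOne ↔ RedSolid 2`**: the GPC-strength child of the first split (stmt-14403, the
route decl by name) is the rung `d + 1 = 2` of the ladder of tails (`redSolid_iff_redPairs_dim` at `d = 1`,
read through the definition). [cite: KontsevichZagier2001, §1.2 Conjecture 1] -/
theorem reductionToDimensionOne_iff_redSolid_two :
    ReductionToDimensionOne ↔
      ∀ R : AddSubgroup KZ.FormalRep, KZ.relations ≤ R →
        (∀ (u v : KZ.IntegralRep 2), (Bornology.IsBounded u.domain ∧ ∀ z ∈ u.domain, u.integrand z = 1) →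
          (Bornology.IsBounded v.domain ∧ ∀ z ∈ v.domain, v.integrand z = 1) → u.value = v.value →
          KZ.of u - KZ.of v ∈ R) →
        ∀ x : KZ.FormalRep, KZ.eval x = 0 → x ∈ R := by
  unfold Summit.KontsevichZagierPeriods.KontsevichZagierPeriods.Theses.AbelContraction.ReductionToDimensionOne
  exact (redSolid_iff_redPairs_dim (d := 1)).symm

end DimOne

end Summit.KontsevichZagierPeriods.AbelContraction.RealArcKernelStubCurrency

end
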